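import Summits.QuantumFields.YangMills.Theorems.LuscherReductionDressedRitzPolyakovLiftShadowVectorCoeff
import HarnessLib

/-!
# Route `LuscherReduction`, item `DressedRitz` (stmt-QuantumFields-20205), line «polyakovlift» r6, stub S-PSCAL″ — NORM-CURRENCY CONCENTRATION OF THE
# SHADOW VECTOR `v = ins_{e0}(f)` from that of its quasimode `Ψ` (F9-V′; LEAD prover ym-lead-20205-polyakovlift g2)

Setting of `…ShadowVectorCoeff`: `e0` normalised physical top eigenfunction, `Φ₀` physical with `a = ⟨Φ₀,e0⟩`, `η = Φ₀ − a e0`, `f` physical bounded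
(`|f| ≤ C_f`), `Ψ` physical with `f·Φ₀ = Ψ` a.e., `v = ins_{e0} f`; `S` a finite set of physical frame vectors `e_k ⊥ e0` (a cluster window of the adapted
eigenbasis).  Writing `in_S(x) = Σ_{k∈S} ⟨x, e_k⟩²`:

* `inMass_transfer`:  `in_S(Ψ) − 2√in_S(Ψ)·‖fη‖ ≤ a²·in_S(v)`  (coefficient identity `a⟨v,e_k⟩ = ⟨Ψ,e_k⟩ − ⟨fη,e_k⟩`, finite Bessel for `fη`);
* `normSq_transfer`:  `a²‖v‖² ≤ (‖Ψ‖ + C_f‖η‖)²`;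
* ★ `concentration_transfer`: if `in_S(Ψ) ≥ (1 − δ)‖Ψ‖²`, `C_f‖η‖ ≤ (ϑ/8)‖Ψ‖`, `δ ≤ ϑ/4`, `0 ≤ ϑ ≤ 1/4`, `a ≠ 0`, `‖Ψ‖ > 0`, then
  `‖v‖² ≤ (1 + ϑ)·in_S(v)` and `in_S(v) > 0` — the single per-vector input of `SpecSum.ratio_two_sided` / `SpecSum.cross_sharp`.

HONEST FRAMING: fixed-lattice bookkeeping (conditional femto rung R2b1); nothing here bears on infinite volume, the continuum limit or the Clay gap.
References: Reed–Simon IV, Thm. XIII.1 [cite: ReedSimonIV1978, Thm. XIII.1]; M. Lüscher, U. Wolff, NPB 339 (1990) 222 [cite: LuscherWolff1990].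
-/

set_option autoImplicit false

noncomputable section

open MeasureTheory Filter Topology Real Finset
open Literature.MathematicalPhysics.QuantumFieldTheory (GaugeConfig Site gaugeTransform)
open scoped BigOperators

namespace Summit.QuantumFields.YangMills.Theorems.FemtoTransferGap.PScal

open Summit.QuantumFields.YangMills.Theorems.FemtoTransferGap

variable {L : ℕ} [NeZero L] {e0 Φ₀ Ψ f : GaugeConfig 3 L SU2 → ℝ}

/-- `(b − d)² ≥ b² − 2|b||d|`. [folklore] -/
theorem sq_sub_ge (b d : ℝ) : b ^ 2 - 2 * (|b| * |d|) ≤ (b - d) ^ 2 := by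
  have h1 : b * d ≤ |b| * |d| := by rw [← abs_mul]; exact le_abs_self _
  nlinarith [sq_nonneg d]

/-- **In-mass transfer**: `in_S(Ψ) − 2√in_S(Ψ)·‖fη‖ ≤ a²·in_S(v)` for a finite window `S` of physical frame vectors orthogonal to `e0`, given finite Bessel
for `fη` on `S`. [cite: ReedSimonIV1978, Thm. XIII.1] -/
theorem inMass_transfer (he0 : IsPhys e0) (hΦ₀ : IsPhys Φ₀) (hΨ : IsPhys Ψ) (hf : IsPhys f) (hprod : f * Φ₀ =ᵐ[configMeasure SU2 L] Ψ)
    (a : ℝ) {S : Finset ℕ} {e : ℕ → GaugeConfig 3 L SU2 → ℝ} (he : ∀ k ∈ S, IsPhys (e k)) (horth : ∀ k ∈ S, l2 e0 (e k) = 0)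
    (hBessel : ∑ k ∈ S, l2 (f * (Φ₀ - a • e0)) (e k) ^ 2 ≤ l2 (f * (Φ₀ - a • e0)) (f * (Φ₀ - a • e0))) :
    ∑ k ∈ S, l2 Ψ (e k) ^ 2 -
        2 * (Real.sqrt (∑ k ∈ S, l2 Ψ (e k) ^ 2) * Real.sqrt (l2 (f * (Φ₀ - a • e0)) (f * (Φ₀ - a • e0)))) ≤
      a ^ 2 * ∑ k ∈ S, l2 (OpPlat.ins e0 f) (e k) ^ 2 := by
  set η := Φ₀ - a • e0 with hη
  -- termwise: `a²⟨v,e_k⟩² = (b_k − d_k)² ≥ b_k² − 2|b_k||d_k|`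
  have hpt : ∀ k ∈ S, l2 Ψ (e k) ^ 2 - 2 * (|l2 Ψ (e k)| * |l2 (f * η) (e k)|) ≤ a ^ 2 * l2 (OpPlat.ins e0 f) (e k) ^ 2 := by
    intro k hk
    have hc := coeff_identity he0 hΦ₀ hΨ hf hprod a (he k hk) (horth k hk)
    have e1 : a ^ 2 * l2 (OpPlat.ins e0 f) (e k) ^ 2 = (a * l2 (OpPlat.ins e0 f) (e k)) ^ 2 := by ring
    rw [e1, hc]
    exact sq_sub_ge _ _
  have hsum := Finset.sum_le_sum hpt
  rw [← Finset.mul_sum, Finset.sum_sub_distrib, ← Finset.mul_sum] at hsum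
  -- Cauchy–Schwarz on `Σ |b_k||d_k|` and finite Bessel on `Σ d_k²`
  have hcs := Real.sum_mul_le_sqrt_mul_sqrt S (fun k => |l2 Ψ (e k)|) (fun k => |l2 (f * η) (e k)|)
  simp only [sq_abs] at hcs
  have hd : Real.sqrt (∑ k ∈ S, l2 (f * η) (e k) ^ 2) ≤ Real.sqrt (l2 (f * η) (f * η)) := Real.sqrt_le_sqrt hBessel
  have h2 : ∑ k ∈ S, |l2 Ψ (e k)| * |l2 (f * η) (e k)| ≤ Real.sqrt (∑ k ∈ S, l2 Ψ (e k) ^ 2) * Real.sqrt (l2 (f * η) (f * η)) :=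
    hcs.trans (mul_le_mul_of_nonneg_left hd (Real.sqrt_nonneg _))
  linarith

/-- **Norm transfer**: `a²‖v‖² ≤ (‖Ψ‖ + C_f‖η‖)²`. [folklore] -/
theorem normSq_transfer (he0 : IsPhys e0) (hn0 : l2 e0 e0 = 1) (hΦ₀ : IsPhys Φ₀) (hΨ : IsPhys Ψ) (hf : IsPhys f)
    (hprod : f * Φ₀ =ᵐ[configMeasure SU2 L] Ψ) {Cf : ℝ} (hCf : ∀ U, |f U| ≤ Cf) (hCf0 : 0 ≤ Cf) (a : ℝ) :
    a ^ 2 * l2 (OpPlat.ins e0 f) (OpPlat.ins e0 f) ≤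
      (Real.sqrt (l2 Ψ Ψ) + Cf * Real.sqrt (l2 (Φ₀ - a • e0) (Φ₀ - a • e0))) ^ 2 := by
  have h1 := mul_le_mul_of_nonneg_left (normSq_ins_le he0 hn0 hf) (sq_nonneg a)
  rw [a_sq_mul_normSq_fe0 hprod a] at h1
  exact h1.trans (normSq_sub_mul_le he0 hΦ₀ hΨ hf hCf hCf0 a)

/-- The numerical heart of the transfer: `(1 + ϑ/8)² ≤ (1 + ϑ)(1 − ϑ/2)` for `0 ≤ ϑ ≤ 1/4`. [folklore] -/
theorem transfer_numerics {ϑ : ℝ} (hϑ0 : 0 ≤ ϑ) (hϑ1 : ϑ ≤ 1 / 4) : (1 + ϑ / 8) ^ 2 ≤ (1 + ϑ) * (1 - ϑ / 2) := by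
  nlinarith

/-- ★ **Concentration transfer** `Ψ ↦ v = ins_{e0} f`: window mass `≥ (1−δ)‖Ψ‖²` for the quasimode and a small contamination `C_f‖η‖ ≤ (ϑ/8)‖Ψ‖` give
`‖v‖² ≤ (1+ϑ)·in_S(v)` and `in_S(v) > 0`. [cite: ReedSimonIV1978, Thm. XIII.1] [cite: LuscherWolff1990] -/
theorem concentration_transfer (he0 : IsPhys e0) (hn0 : l2 e0 e0 = 1) (hΦ₀ : IsPhys Φ₀) (hΨ : IsPhys Ψ) (hf : IsPhys f)
    (hprod : f * Φ₀ =ᵐ[configMeasure SU2 L] Ψ) {Cf : ℝ} (hCf : ∀ U, |f U| ≤ Cf) (hCf0 : 0 ≤ Cf) {a : ℝ} (ha : a ≠ 0)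
    {S : Finset ℕ} {e : ℕ → GaugeConfig 3 L SU2 → ℝ} (he : ∀ k ∈ S, IsPhys (e k)) (horth : ∀ k ∈ S, l2 e0 (e k) = 0)
    (hBesselη : ∑ k ∈ S, l2 (f * (Φ₀ - a • e0)) (e k) ^ 2 ≤ l2 (f * (Φ₀ - a • e0)) (f * (Φ₀ - a • e0)))
    (hBesselΨ : ∑ k ∈ S, l2 Ψ (e k) ^ 2 ≤ l2 Ψ Ψ) (hΨpos : 0 < l2 Ψ Ψ)
    {δ ϑ : ℝ} (hϑ0 : 0 ≤ ϑ) (hϑ1 : ϑ ≤ 1 / 4) (hδ : δ ≤ ϑ / 4) (hin : (1 - δ) * l2 Ψ Ψ ≤ ∑ k ∈ S, l2 Ψ (e k) ^ 2)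
    (hsmall : Cf * Real.sqrt (l2 (Φ₀ - a • e0) (Φ₀ - a • e0)) ≤ ϑ / 8 * Real.sqrt (l2 Ψ Ψ)) :
    l2 (OpPlat.ins e0 f) (OpPlat.ins e0 f) ≤ (1 + ϑ) * ∑ k ∈ S, l2 (OpPlat.ins e0 f) (e k) ^ 2 ∧
      0 < ∑ k ∈ S, l2 (OpPlat.ins e0 f) (e k) ^ 2 := by
  set η := Φ₀ - a • e0 with hη
  set v := OpPlat.ins e0 f with hv
  set s := Real.sqrt (l2 Ψ Ψ) with hs
  set inΨ := ∑ k ∈ S, l2 Ψ (e k) ^ 2 with hinΨ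
  set inv := ∑ k ∈ S, l2 v (e k) ^ 2 with hinv
  have hs0 : 0 < s := Real.sqrt_pos.2 hΨpos
  have hss : s ^ 2 = l2 Ψ Ψ := Real.sq_sqrt hΨpos.le
  have ha2 : 0 < a ^ 2 := by positivity
  -- contamination `‖fη‖ ≤ C_f‖η‖ ≤ (ϑ/8) s`
  have hη' : IsPhys η := ((⟨Φ₀, hΦ₀⟩ : physSubmodule L) - a • (⟨e0, he0⟩ : physSubmodule L)).2
  have hfη : Real.sqrt (l2 (f * η) (f * η)) ≤ Cf * Real.sqrt (l2 η η) := by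
    have h := normSq_mul_le hf hη' hCf
    calc Real.sqrt (l2 (f * η) (f * η)) ≤ Real.sqrt (Cf ^ 2 * l2 η η) := Real.sqrt_le_sqrt h
      _ = Cf * Real.sqrt (l2 η η) := by rw [Real.sqrt_mul (sq_nonneg _), Real.sqrt_sq hCf0]
  have hρ : Real.sqrt (l2 (f * η) (f * η)) ≤ ϑ / 8 * s := hfη.trans hsmall
  -- in-mass from below
  have hT := inMass_transfer he0 hΦ₀ hΨ hf hprod a he horth hBesselη
  have hsqin : Real.sqrt inΨ ≤ s := Real.sqrt_le_sqrt hBesselΨ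
  have hcross : Real.sqrt inΨ * Real.sqrt (l2 (f * η) (f * η)) ≤ s * (ϑ / 8 * s) :=
    mul_le_mul hsqin hρ (Real.sqrt_nonneg _) hs0.le
  have hlow : (1 - ϑ / 2) * s ^ 2 ≤ a ^ 2 * inv := by
    rw [hss]
    have : (1 - δ) * l2 Ψ Ψ - 2 * (s * (ϑ / 8 * s)) ≤ a ^ 2 * inv := by linarith [hT, hin, hcross]
    nlinarith [this, hss, hΨpos]
  -- norm from above
  have hN := normSq_transfer he0 hn0 hΦ₀ hΨ hf hprod hCf hCf0 a
  have hN' : a ^ 2 * l2 v v ≤ (1 + ϑ / 8) ^ 2 * s ^ 2 := by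
    have h1 : Real.sqrt (l2 Ψ Ψ) + Cf * Real.sqrt (l2 η η) ≤ (1 + ϑ / 8) * s := by rw [← hs]; linarith [hsmall]
    have h0 : 0 ≤ Real.sqrt (l2 Ψ Ψ) + Cf * Real.sqrt (l2 η η) := by positivity
    calc a ^ 2 * l2 v v ≤ (Real.sqrt (l2 Ψ Ψ) + Cf * Real.sqrt (l2 η η)) ^ 2 := hN
      _ ≤ ((1 + ϑ / 8) * s) ^ 2 := pow_le_pow_left₀ h0 h1 2
      _ = (1 + ϑ / 8) ^ 2 * s ^ 2 := by ring
  have hnum := transfer_numerics hϑ0 hϑ1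
  have hinvpos : 0 < inv := by
    have : 0 < (1 - ϑ / 2) * s ^ 2 := mul_pos (by linarith) (pow_pos hs0 2)
    have h := lt_of_lt_of_le this hlow
    exact (pos_iff_pos_of_mul_pos h).1 ha2
  refine ⟨?_, hinvpos⟩
  -- `a²‖v‖² ≤ (1+ϑ/8)² s² ≤ (1+ϑ)(1−ϑ/2) s² ≤ (1+ϑ) a² inv`, then cancel `a² > 0`
  have h3 : a ^ 2 * l2 v v ≤ a ^ 2 * ((1 + ϑ) * inv) := by
    have h4 : (1 + ϑ / 8) ^ 2 * s ^ 2 ≤ (1 + ϑ) * ((1 - ϑ / 2) * s ^ 2) := by nlinarith [pow_pos hs0 2]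
    have h5 : (1 + ϑ) * ((1 - ϑ / 2) * s ^ 2) ≤ (1 + ϑ) * (a ^ 2 * inv) := mul_le_mul_of_nonneg_left hlow (by linarith)
    nlinarith [hN', h4, h5]
  exact le_of_mul_le_mul_left h3 ha2

end Summit.QuantumFields.YangMills.Theorems.FemtoTransferGap.PScal

end
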